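/-
Copyright (c) 2026 the pub-hodgecm-mathlib formalisation cell (harness21).  Prover seat hodgecm-mathlib-LH4-p04 (g3), req620 Track A «(D-RAM) FOUR-FRAME» squad
(unit U2H_HSide, the (ρ2b′-X) payer road of LH4-p14 (g3) (RHO2BX-ORDER v1, organ O-Sum ∕ T5s «TORIC CENSUS SUM», TYPE U); dealer∕pen LH4-plan (g12) WORD #21∕#22, LH4-p14 (g3)
04:08Z hand-over; letters of record = LH4-p08 (g4) T5a sheet v3 via LH4-p10 (g3)'s socket read 04:13Z (a)(b)(c); inputs E1 v1 (F0P3a-p01 (g32)) ∕ p14's frozen census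
`osum_typeU_identity.v2` fa1812e2; REF5 (g23) R5-152 Lean-semantics read (7 760 tuples).  2026-09-04.
-/
import Summits.HodgeConjecture.HodgeConjecture.Theorems.F0P3cDyRamToricCensusSumUnrBlocks   -- FILE 1 (this seat): re-indexing tools, `colP_eval`, `rowM_eval`
import HarnessLib

/-!
# Crux `H413`, line LH4 «(D-RAM) FOUR-FRAME» road — unit U2H (ii-H), the (ρ2b′-X) payer: O-Sum ∕ T5s «TORIC CENSUS SUM», TYPE U — FILE 2∕3 «PARTS»:
# the two sides of the census summed in closed form, the LOW block, and the arithmetic of the two token branches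

Cell `hodgecm-mathlib` (D-0151), FLOOR 0, crux item H413 = `stmt-HodgeConjecture-24833`; squad F0∕P3c∕LH4; registered stub served: `F0P3cDyRamFourFrameU2H.stub_U2H_fixedPointCensus_typeTwo_unit0`
((ρ2b′-X), U2H ED. 15 :418) through the ★ spine of LH4-p14 (g3) (organ O-Sum).  THEOREMS ONLY (no `def`, no instance, no notation, no `sorry`, default heartbeats); lane
`--supports stmt-HodgeConjecture-24833 --as helper` (count-neutral).  Pure finite-sum bookkeeping over `ℚ`.

CONTENT.  `sumP_eval`: `Σ_j Σ_a x^a vP j a = A0₊^{<d} + (x+1)x^{d−1}Σ_{u ≤ L}x^u + Σ_{i < min(⌊m∕2⌋, L)} (x²−1)x^{2i+d}Σ_{u<L−i}x^u + [m + d ≤ jl, jl−m−d even](x+1)x^{⌊m∕2⌋+1+E}Σ_{i<m−1−⌊m∕2⌋}x^i`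
(`Finset.sum_comm`, the column `a = 0` by parity re-indexing, the columns `a ≥ 1` by FILE 1 `colP_eval` + window re-indexing); `sumM_eval`: `Σ_j Σ_a x^a vM j a = A0₋ +
(x+1)x^dΣ_{i<⌊m∕2⌋}x^{2i} + [jl + 1 = d + m](x+1)x^{d+m−1}Σ_{i<jl−d−⌊m∕2⌋}x^i` (FILE 1 `rowM_eval` row by row); `low_block_mul`; `algebra_pos` ∕ `algebra_neg`: after ONE
multiplication by `x − 1` every block is closed, `d + L = n_H + 1`, the three `(x+1)`-blocks telescope, and the identity is `ring` in the atoms `x^L, x^{⌊m∕2⌋}, x^{d−1}, x` per parity of `d`.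
HONEST LABEL.  Count-neutral (`--supports`); nothing printed is asserted; (ρ2b′-X) `stub_U2H_fixedPointCensus_typeTwo_unit0` (U2H :418) stays a PROVER TARGET (an empirical
census law, kit-confirmed) until its payer lands; `HC_CM` is proved only modulo the 7 printed citations (2 remaining named inputs: hLiu418 = `stmt-HodgeConjecture-24832`, h413 =
`stmt-HodgeConjecture-24833`) until rung 0 closes.

## References
* [Kottwitz1986BaseChangeUnits] R. E. Kottwitz, *Base change for unit elements of Hecke algebras*, Compositio Math. 60 (1986), §1 pp. 240–241 (orbital integrals of units as
  lattice counts modulo the torus).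
* [Rogawski1990] J. D. Rogawski, *Automorphic Representations of Unitary Groups in Three Variables*, Ann. of Math. Stud. 123 (1990), §4.9 Prop. 4.9.1 (b) p. 55, Lemma 4.9.3 p. 56
  (the fixed-point census of a type-(2) element; the toric decomposition).
-/

set_option autoImplicit false

namespace Summit.HodgeConjecture.HodgeConjecture.Cruxes.H413.F0P3cDyRamToricCensusSumUnrParts

open Finset
open Summit.HodgeConjecture.HodgeConjecture.Cruxes.H413.F0P3cDyRamToricCensusSumUnrBlocks

/-- **THE `+` SIDE SUMMED**: column `a = 0` (below ∕ above the conductor) + the LOW block + the TOP diagonal. [folklore] -/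
theorem sumP_eval (x : ℚ) (hx0 : x ≠ 0) (hx1 : x ≠ 1) {d jl m : ℕ} (hd : 2 ≤ d) (hm : m ≤ jl) (hdjl : d ≤ jl)
    (nP vP : ℕ → ℕ → ℚ)
    (hnP : ∀ j a, 1 ≤ a → nP j a = if a + d ≤ j ∧ (j - a - d) % 2 = 0 then (x ^ 2 - 1) * x ^ (j - 2 - (j - a - d) / 2) else 0)
    (hnP0 : ∀ j, nP j 0 = if (j + d) % 2 = 0 then (if d ≤ j then (x + 1) * x ^ ((j + d) / 2 - 1) else (if j = 0 then (1 : ℚ) else (x + 1) * x ^ (j - 1))) else 0)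
    (hv0P : ∀ j, vP j 0 = nP j 0)
    (hvOffP : ∀ j a, 1 ≤ a → j + m ≠ jl + a → vP j a = if 2 * a ≤ m ∧ (j + a ≤ m ∨ j + a ≤ jl) then nP j a else 0)
    (hvLowP : ∀ j a, 1 ≤ a → j + m = jl + a → 2 * a ≤ m → vP j a = nP j a)
    (hvTopP : ∀ j a, 1 ≤ a → j + m = jl + a → m < 2 * a →
      vP j a = if d + m ≤ jl ∧ j < jl then nP j a / ((x - 1) * x ^ ((2 * a - m + 1) / 2 - 1)) else 0) :
    ∑ j ∈ range (jl + 1), ∑ a ∈ range (jl + 2), x ^ a * vP j a =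
      ∑ j ∈ range d, (if j % 2 = d % 2 then (if j = 0 then (1 : ℚ) else (x + 1) * x ^ (j - 1)) else 0) +
      (x + 1) * x ^ (d - 1) * ∑ u ∈ range ((jl - d) / 2 + 1), x ^ u +
      ∑ i ∈ range (min (m / 2) ((jl - d) / 2)), (x ^ 2 - 1) * x ^ (2 * i + d) * ∑ u ∈ range ((jl - d) / 2 - i), x ^ u +
      (if m + d ≤ jl ∧ (jl - m - d) % 2 = 0 then
        (x + 1) * x ^ (m / 2 + 1 + (d + (jl - m - d) / 2 + m / 2 - 1)) * ∑ i ∈ range (m - 1 - m / 2), x ^ i else 0) := by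
  rw [Finset.sum_comm, Finset.sum_range_succ']
  -- the column `a = 0`
  have hcol0 : ∑ j ∈ range (jl + 1), x ^ 0 * vP j 0 =
      ∑ j ∈ range d, (if j % 2 = d % 2 then (if j = 0 then (1 : ℚ) else (x + 1) * x ^ (j - 1)) else 0) +
      (x + 1) * x ^ (d - 1) * ∑ u ∈ range ((jl - d) / 2 + 1), x ^ u := by
    have hsplit : ∀ j ∈ range (jl + 1), x ^ 0 * vP j 0 =
        (if 0 ≤ j ∧ j < 0 + d then (if j % 2 = d % 2 then (if j = 0 then (1 : ℚ) else (x + 1) * x ^ (j - 1)) else 0) else 0) +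
        (if d ≤ j ∧ (j - d) % 2 = 0 then (x + 1) * x ^ ((j + d) / 2 - 1) else 0) := by
      intro j _
      rw [pow_zero, one_mul, hv0P, hnP0]
      by_cases hjd : j < d
      · rw [if_pos (show 0 ≤ j ∧ j < 0 + d from ⟨Nat.zero_le _, by omega⟩), if_neg (show ¬ (d ≤ j ∧ (j - d) % 2 = 0) from fun h => by omega), add_zero]
        by_cases hp : (j + d) % 2 = 0
        · rw [if_pos hp, if_pos (show j % 2 = d % 2 by omega), if_neg (by omega)]
        · rw [if_neg hp, if_neg (show ¬ (j % 2 = d % 2) from fun h => hp (by omega))]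
      · rw [if_neg (show ¬ (0 ≤ j ∧ j < 0 + d) from fun h => by omega), zero_add]
        by_cases hp : (j + d) % 2 = 0
        · rw [if_pos hp, if_pos (by omega), if_pos (show d ≤ j ∧ (j - d) % 2 = 0 from ⟨by omega, by omega⟩)]
        · rw [if_neg hp, if_neg (show ¬ (d ≤ j ∧ (j - d) % 2 = 0) from fun h => hp (by omega))]
    rw [Finset.sum_congr rfl hsplit, Finset.sum_add_distrib, sum_range_window_reindex _ (by omega : 0 + d ≤ jl + 1),
      sum_range_parity_reindex (fun j => (x + 1) * x ^ ((j + d) / 2 - 1)) d jl, Finset.mul_sum]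
    congr 1
    · refine Finset.sum_congr rfl fun j _ => ?_
      rw [zero_add]
    · rw [show (jl + 2 - d) / 2 = (jl - d) / 2 + 1 by omega]
      refine Finset.sum_congr rfl fun u _ => ?_
      rw [show (d + 2 * u + d) / 2 - 1 = (d - 1) + u by omega, pow_add]
      ring
  -- the columns `a ≥ 1`
  have hcols : ∀ a ∈ range (jl + 1), ∑ j ∈ range (jl + 1), x ^ (a + 1) * vP j (a + 1) =
      (if 0 ≤ a ∧ a < 0 + min (m / 2) ((jl - d) / 2) then (x ^ 2 - 1) * x ^ (2 * a + d) * ∑ u ∈ range ((jl - d) / 2 - a), x ^ u else 0) +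
      (if m + d ≤ jl ∧ (jl - m - d) % 2 = 0 then
        (if m / 2 ≤ a ∧ a < m / 2 + (m - 1 - m / 2) then (x + 1) * x ^ (m / 2 + 1 + (d + (jl - m - d) / 2 + m / 2 - 1)) * x ^ (a - m / 2) else 0) else 0) := by
    intro a _
    rw [colP_eval x hx0 hx1 hd hm nP vP hnP hvOffP hvLowP hvTopP (a + 1) (by omega)]
    congr 1
    · by_cases hc : 2 * (a + 1) ≤ m ∧ 2 * (a + 1) + d ≤ jl
      · rw [if_pos hc, if_pos (show 0 ≤ a ∧ a < 0 + min (m / 2) ((jl - d) / 2) from ⟨Nat.zero_le _, by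
            rw [zero_add, lt_min_iff]; omega⟩),
          show 2 * (a + 1) + d - 2 = 2 * a + d by omega, show (jl - d) / 2 - (a + 1) + 1 = (jl - d) / 2 - a by omega]
      · rw [if_neg hc, if_neg (show ¬ (0 ≤ a ∧ a < 0 + min (m / 2) ((jl - d) / 2)) from fun h => hc (by
            have := h.2; rw [zero_add, lt_min_iff] at this; omega))]
    · by_cases hg : m + d ≤ jl ∧ (jl - m - d) % 2 = 0
      · rw [if_pos hg]
        by_cases hw : m < 2 * (a + 1) ∧ a + 1 < m
        · rw [if_pos (show m < 2 * (a + 1) ∧ a + 1 < m ∧ m + d ≤ jl ∧ (jl - m - d) % 2 = 0 from ⟨hw.1, hw.2, hg⟩),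
            if_pos (show m / 2 ≤ a ∧ a < m / 2 + (m - 1 - m / 2) from by omega), mul_assoc, ← pow_add]
          congr 2; omega
        · rw [if_neg (show ¬ (m < 2 * (a + 1) ∧ a + 1 < m ∧ m + d ≤ jl ∧ (jl - m - d) % 2 = 0) from fun h => hw ⟨h.1, h.2.1⟩),
            if_neg (show ¬ (m / 2 ≤ a ∧ a < m / 2 + (m - 1 - m / 2)) from fun h => hw (by omega))]
      · rw [if_neg hg, if_neg (show ¬ (m < 2 * (a + 1) ∧ a + 1 < m ∧ m + d ≤ jl ∧ (jl - m - d) % 2 = 0) from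
          fun h => hg ⟨h.2.2.1, h.2.2.2⟩)]
  rw [hcol0, Finset.sum_congr rfl hcols, Finset.sum_add_distrib,
    sum_range_window_reindex _ (by have := Nat.min_le_right (m / 2) ((jl - d) / 2); omega : 0 + min (m / 2) ((jl - d) / 2) ≤ jl + 1)]
  have htop : ∑ a ∈ range (jl + 1), (if m + d ≤ jl ∧ (jl - m - d) % 2 = 0 then
      (if m / 2 ≤ a ∧ a < m / 2 + (m - 1 - m / 2) then (x + 1) * x ^ (m / 2 + 1 + (d + (jl - m - d) / 2 + m / 2 - 1)) * x ^ (a - m / 2) else 0) else 0) =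
      (if m + d ≤ jl ∧ (jl - m - d) % 2 = 0 then
        (x + 1) * x ^ (m / 2 + 1 + (d + (jl - m - d) / 2 + m / 2 - 1)) * ∑ i ∈ range (m - 1 - m / 2), x ^ i else 0) := by
    by_cases hg : m + d ≤ jl ∧ (jl - m - d) % 2 = 0
    · simp_rw [if_pos hg]
      rw [sum_range_window_reindex _ (by omega : m / 2 + (m - 1 - m / 2) ≤ jl + 1), Finset.mul_sum]
      refine Finset.sum_congr rfl fun i _ => ?_
      rw [show m / 2 + i - m / 2 = i by omega]
    · simp_rw [if_neg hg]
      rw [Finset.sum_const_zero]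
  rw [htop]
  simp_rw [zero_add]
  ring

/-- **THE `−` SIDE SUMMED**: the rows below the conductor + the LOW cells `d ≤ j ≤ d − 1 + ⌊m∕2⌋` + the TOP diagonal (`jl + 1 = d + m`). [folklore] -/
theorem sumM_eval (x : ℚ) (hx0 : x ≠ 0) {d jl m : ℕ} (hd : 2 ≤ d) (hm : m ≤ jl - d + 1) (hdjl : d ≤ jl)
    (nM vM : ℕ → ℕ → ℚ)
    (hnM : ∀ j a, nM j a = if (d ≤ j + 1 ∧ a + d = j + 1) ∨ (j + 1 < d ∧ a = 0 ∧ (j + d) % 2 = 1) then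
      (if j = 0 then (1 : ℚ) else (x + 1) * x ^ (j - 1)) else 0)
    (hv0M : ∀ j, vM j 0 = nM j 0)
    (hvOffM : ∀ j a, 1 ≤ a → j + m ≠ jl + a → vM j a = if 2 * a ≤ m ∧ (j + a ≤ m ∨ j + a ≤ jl) then nM j a else 0)
    (hvLowM : ∀ j a, 1 ≤ a → j + m = jl + a → 2 * a ≤ m → vM j a = nM j a)
    (hvTopM : ∀ j a, 1 ≤ a → j + m = jl + a → m < 2 * a → vM j a = if jl + 1 = d + m ∧ j < jl then nM j a / x ^ ((2 * a - m) / 2) else 0) :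
    ∑ j ∈ range (jl + 1), ∑ a ∈ range (jl + 2), x ^ a * vM j a =
      ∑ j ∈ range d, (if j % 2 ≠ d % 2 then (if j = 0 then (1 : ℚ) else (x + 1) * x ^ (j - 1)) else 0) +
      (x + 1) * x ^ d * ∑ i ∈ range (m / 2), x ^ (2 * i) +
      (if jl + 1 = d + m then (x + 1) * x ^ (d + m - 1) * ∑ i ∈ range (jl - d - m / 2), x ^ i else 0) := by
  have hrows : ∀ j ∈ range (jl + 1), ∑ a ∈ range (jl + 2), x ^ a * vM j a =
      (if 0 ≤ j ∧ j < 0 + d then (if j % 2 ≠ d % 2 then (if j = 0 then (1 : ℚ) else (x + 1) * x ^ (j - 1)) else 0) else 0) +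
      (if d ≤ j ∧ j < d + m / 2 then (x + 1) * x ^ d * x ^ (2 * (j - d)) else 0) +
      (if jl + 1 = d + m then
        (if d + m / 2 ≤ j ∧ j < d + m / 2 + (jl - d - m / 2) then (x + 1) * x ^ (d + m - 1) * x ^ (j - (d + m / 2)) else 0) else 0) := by
    intro j hj
    rw [Finset.mem_range] at hj
    rw [rowM_eval x hx0 hd hm hdjl nM vM hnM hv0M hvOffM hvLowM hvTopM j (by omega)]
    congr 1
    · congr 1
      · by_cases hjd : j < d
        · rw [if_pos (show 0 ≤ j ∧ j < 0 + d from ⟨Nat.zero_le _, by omega⟩)]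
          by_cases hp : j % 2 ≠ d % 2
          · rw [if_pos ⟨hjd, hp⟩, if_pos hp]
          · rw [if_neg (fun h => hp h.2), if_neg hp]
        · rw [if_neg (fun h => hjd h.1), if_neg (show ¬ (0 ≤ j ∧ j < 0 + d) from fun h => by omega)]
      · by_cases hc : d ≤ j ∧ j ≤ d - 1 + m / 2
        · rw [if_pos hc, if_pos (show d ≤ j ∧ j < d + m / 2 from by omega), mul_assoc, ← pow_add]
          congr 2; omega
        · rw [if_neg hc, if_neg (show ¬ (d ≤ j ∧ j < d + m / 2) from fun h => hc (by omega))]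
    · by_cases hg : jl + 1 = d + m
      · rw [if_pos hg]
        by_cases hw : d + m / 2 ≤ j ∧ j < jl
        · rw [if_pos (show d + m / 2 ≤ j ∧ j < jl ∧ jl + 1 = d + m from ⟨hw.1, hw.2, hg⟩),
            if_pos (show d + m / 2 ≤ j ∧ j < d + m / 2 + (jl - d - m / 2) from by omega), mul_assoc, ← pow_add]
          congr 2; omega
        · rw [if_neg (show ¬ (d + m / 2 ≤ j ∧ j < jl ∧ jl + 1 = d + m) from fun h => hw ⟨h.1, h.2.1⟩),
            if_neg (show ¬ (d + m / 2 ≤ j ∧ j < d + m / 2 + (jl - d - m / 2)) from fun h => hw (by omega))]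
      · rw [if_neg hg, if_neg (show ¬ (d + m / 2 ≤ j ∧ j < jl ∧ jl + 1 = d + m) from fun h => hg h.2.2)]
  rw [Finset.sum_congr rfl hrows, Finset.sum_add_distrib, Finset.sum_add_distrib,
    sum_range_window_reindex _ (by omega : 0 + d ≤ jl + 1), sum_range_window_reindex _ (by omega : d + m / 2 ≤ jl + 1)]
  have htop : ∑ j ∈ range (jl + 1), (if jl + 1 = d + m then
      (if d + m / 2 ≤ j ∧ j < d + m / 2 + (jl - d - m / 2) then (x + 1) * x ^ (d + m - 1) * x ^ (j - (d + m / 2)) else 0) else 0) =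
      (if jl + 1 = d + m then (x + 1) * x ^ (d + m - 1) * ∑ i ∈ range (jl - d - m / 2), x ^ i else 0) := by
    by_cases hg : jl + 1 = d + m
    · simp_rw [if_pos hg]
      rw [sum_range_window_reindex _ (by omega : d + m / 2 + (jl - d - m / 2) ≤ jl + 1), Finset.mul_sum]
      refine Finset.sum_congr rfl fun i _ => ?_
      rw [show d + m / 2 + i - (d + m / 2) = i by omega]
    · simp_rw [if_neg hg]
      rw [Finset.sum_const_zero]
  have hmid : ∑ i ∈ range (m / 2), (x + 1) * x ^ d * x ^ (2 * (d + i - d)) = (x + 1) * x ^ d * ∑ i ∈ range (m / 2), x ^ (2 * i) := by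
    rw [Finset.mul_sum]
    refine Finset.sum_congr rfl fun i _ => ?_
    rw [show d + i - d = i by omega]
  rw [htop, hmid]
  simp_rw [Nat.zero_add]

/-- The LOW block times `x − 1`: `(x−1)·Σ_{i<h} (x²−1)x^{2i+d}·Σ_{u<L−i} x^u = (x+1)x^{d−1}x^L·x·(x^h − 1) − x^{d−1}x·(x^{2h} − 1)` (`h ≤ L`). [folklore] -/
theorem low_block_mul (x : ℚ) {d L h : ℕ} (hd : 1 ≤ d) (hhL : h ≤ L) :
    (x - 1) * ∑ i ∈ range h, (x ^ 2 - 1) * x ^ (2 * i + d) * ∑ u ∈ range (L - i), x ^ u =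
      (x + 1) * (x ^ (d - 1) * x ^ L * x) * (x ^ h - 1) - x ^ (d - 1) * x * (x ^ h * x ^ h - 1) := by
  rw [Finset.mul_sum]
  have hterm : ∀ i ∈ range h, (x - 1) * ((x ^ 2 - 1) * x ^ (2 * i + d) * ∑ u ∈ range (L - i), x ^ u) =
      (x + 1) * (x ^ (d - 1) * x ^ L * x) * ((x - 1) * x ^ i) - x ^ (d - 1) * x * ((x ^ 2 - 1) * x ^ (2 * i)) := by
    intro i hi
    rw [Finset.mem_range] at hi
    have e1 : x ^ (2 * i + d) * x ^ (L - i) = x ^ (d - 1) * x ^ L * x * x ^ i := by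
      rw [← pow_add, ← pow_add, ← pow_succ, ← pow_add]; congr 1; omega
    have e2 : x ^ (2 * i + d) = x ^ (d - 1) * x * x ^ (2 * i) := by
      rw [← pow_succ, ← pow_add]; congr 1; omega
    calc (x - 1) * ((x ^ 2 - 1) * x ^ (2 * i + d) * ∑ u ∈ range (L - i), x ^ u)
        = (x ^ 2 - 1) * x ^ (2 * i + d) * ((x - 1) * ∑ u ∈ range (L - i), x ^ u) := by ring
      _ = (x ^ 2 - 1) * x ^ (2 * i + d) * (x ^ (L - i) - 1) := by rw [geom_sum_mul']
      _ = (x ^ 2 - 1) * (x ^ (2 * i + d) * x ^ (L - i)) - (x ^ 2 - 1) * x ^ (2 * i + d) := by ring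
      _ = _ := by rw [e1, e2]; ring
  rw [Finset.sum_congr rfl hterm, Finset.sum_sub_distrib]
  have s1 : ∑ i ∈ range h, (x + 1) * (x ^ (d - 1) * x ^ L * x) * ((x - 1) * x ^ i) = (x + 1) * (x ^ (d - 1) * x ^ L * x) * ((x - 1) * ∑ i ∈ range h, x ^ i) := by
    rw [Finset.mul_sum, Finset.mul_sum]
  have s2 : ∑ i ∈ range h, x ^ (d - 1) * x * ((x ^ 2 - 1) * x ^ (2 * i)) = x ^ (d - 1) * x * ((x ^ 2 - 1) * ∑ i ∈ range h, x ^ (2 * i)) := by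
    rw [Finset.mul_sum, Finset.mul_sum]
  rw [s1, s2, geom_sum_mul', geom_sum_two_mul, show x ^ (2 * h) = x ^ h * x ^ h by rw [← pow_add]; congr 1; omega]

/-- THE ARITHMETIC, `ε = +1` branch (`m ≡ d (mod 2)`, `1 ≤ m ≤ jl − d`): the `(x+1)`-blocks telescope to `(x+1)(x^{n_H+m} − x^{d−1})` and everything collapses to
`x^m·((x+1)x^{n_H} − 2x^{S})∕(x−1)`-form. [folklore] -/
theorem algebra_pos (x : ℚ) (hx1 : x ≠ 1) {d jl m : ℕ} (hd : 2 ≤ d) (hpar : m % 2 = d % 2) (hm1 : 1 ≤ m) (hmd : m + d ≤ jl) (hjl : jl % 2 = 0)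
    (A0P A0M : ℚ) (hA0 : A0P - A0M = -x ^ (d - 1)) :
    (A0P + (x + 1) * x ^ (d - 1) * ∑ u ∈ range ((jl - d) / 2 + 1), x ^ u +
        ∑ i ∈ range (m / 2), (x ^ 2 - 1) * x ^ (2 * i + d) * ∑ u ∈ range ((jl - d) / 2 - i), x ^ u +
        (x + 1) * x ^ (m / 2 + 1 + (d + (jl - m - d) / 2 + m / 2 - 1)) * ∑ i ∈ range (m - 1 - m / 2), x ^ i) -
      (A0M + (x + 1) * x ^ d * ∑ i ∈ range (m / 2), x ^ (2 * i)) =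
      x ^ m * ((1 + (x + 1) * ∑ i ∈ range ((jl + (d - d % 2) - 2) / 2), x ^ i) - 2 * ∑ i ∈ range (d - d % 2), x ^ i) := by
  set L := (jl - d) / 2 with hL
  set h := m / 2 with hh
  have hhL : h ≤ L := by omega
  apply mul_left_cancel₀ (sub_ne_zero.2 hx1)
  -- every block times `x − 1`, in the atoms `x^L`, `x^h`, `x^{d−1}`, `x`
  have t1 : (x - 1) * ((x + 1) * x ^ (d - 1) * ∑ u ∈ range (L + 1), x ^ u) = (x + 1) * x ^ (d - 1) * (x ^ L * x - 1) := by
    rw [show (x - 1) * ((x + 1) * x ^ (d - 1) * ∑ u ∈ range (L + 1), x ^ u) = (x + 1) * x ^ (d - 1) * ((x - 1) * ∑ u ∈ range (L + 1), x ^ u) by ring,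
      geom_sum_mul', pow_succ]
  have t2 := low_block_mul x (d := d) (L := L) (h := h) (by omega) hhL
  have t3 : (x - 1) * ((x + 1) * x ^ (h + 1 + (d + (jl - m - d) / 2 + h - 1)) * ∑ i ∈ range (m - 1 - h), x ^ i) =
      (x + 1) * (x ^ h * x ^ h * x ^ (m % 2) * x ^ (d - 1) * x ^ L - x ^ h * x * x ^ (d - 1) * x ^ L) := by
    have e1 : x ^ (h + 1 + (d + (jl - m - d) / 2 + h - 1)) = x ^ h * x * x ^ (d - 1) * x ^ L := by
      rw [← pow_succ, ← pow_add, ← pow_add]; congr 1; omega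
    have e2 : x ^ h * x * x ^ (d - 1) * x ^ L * x ^ (m - 1 - h) = x ^ h * x ^ h * x ^ (m % 2) * x ^ (d - 1) * x ^ L := by
      rw [← pow_succ, ← pow_add, ← pow_add, ← pow_add, ← pow_add, ← pow_add, ← pow_add, ← pow_add]; congr 1; omega
    rw [show (x - 1) * ((x + 1) * x ^ (h + 1 + (d + (jl - m - d) / 2 + h - 1)) * ∑ i ∈ range (m - 1 - h), x ^ i) =
      (x + 1) * x ^ (h + 1 + (d + (jl - m - d) / 2 + h - 1)) * ((x - 1) * ∑ i ∈ range (m - 1 - h), x ^ i) by ring, geom_sum_mul', e1, ← e2]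
    ring
  have t4 : (x - 1) * ((x + 1) * x ^ d * ∑ i ∈ range h, x ^ (2 * i)) = x ^ (d - 1) * x * (x ^ h * x ^ h - 1) := by
    rw [show (x - 1) * ((x + 1) * x ^ d * ∑ i ∈ range h, x ^ (2 * i)) = x ^ d * ((x ^ 2 - 1) * ∑ i ∈ range h, x ^ (2 * i)) by ring,
      geom_sum_two_mul, show x ^ (2 * h) = x ^ h * x ^ h by rw [← pow_add]; congr 1; omega, show x ^ d = x ^ (d - 1) * x by rw [← pow_succ]; congr 1; omega]
  have t5 : (x - 1) * (x ^ m * ((1 + (x + 1) * ∑ i ∈ range ((jl + (d - d % 2) - 2) / 2), x ^ i) - 2 * ∑ i ∈ range (d - d % 2), x ^ i)) =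
      x ^ h * x ^ h * x ^ (m % 2) * ((x - 1) + (x + 1) * (x ^ (d - 1) * x ^ L - 1) - 2 * (x ^ (d - d % 2) - 1)) := by
    have e1 : x ^ m = x ^ h * x ^ h * x ^ (m % 2) := by rw [← pow_add, ← pow_add]; congr 1; omega
    have e2 : x ^ ((jl + (d - d % 2) - 2) / 2) = x ^ (d - 1) * x ^ L := by rw [← pow_add]; congr 1; omega
    rw [show (x - 1) * (x ^ m * ((1 + (x + 1) * ∑ i ∈ range ((jl + (d - d % 2) - 2) / 2), x ^ i) - 2 * ∑ i ∈ range (d - d % 2), x ^ i)) =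
      x ^ m * ((x - 1) + (x + 1) * ((x - 1) * ∑ i ∈ range ((jl + (d - d % 2) - 2) / 2), x ^ i) - 2 * ((x - 1) * ∑ i ∈ range (d - d % 2), x ^ i)) by ring,
      geom_sum_mul', geom_sum_mul', e1, e2]
  rw [show (x - 1) * (A0P + (x + 1) * x ^ (d - 1) * ∑ u ∈ range (L + 1), x ^ u +
        ∑ i ∈ range h, (x ^ 2 - 1) * x ^ (2 * i + d) * ∑ u ∈ range (L - i), x ^ u +
        (x + 1) * x ^ (h + 1 + (d + (jl - m - d) / 2 + h - 1)) * ∑ i ∈ range (m - 1 - h), x ^ i -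
      (A0M + (x + 1) * x ^ d * ∑ i ∈ range h, x ^ (2 * i))) =
      (x - 1) * (A0P - A0M) + (x - 1) * ((x + 1) * x ^ (d - 1) * ∑ u ∈ range (L + 1), x ^ u) +
        (x - 1) * ∑ i ∈ range h, (x ^ 2 - 1) * x ^ (2 * i + d) * ∑ u ∈ range (L - i), x ^ u +
        (x - 1) * ((x + 1) * x ^ (h + 1 + (d + (jl - m - d) / 2 + h - 1)) * ∑ i ∈ range (m - 1 - h), x ^ i) -
      (x - 1) * ((x + 1) * x ^ d * ∑ i ∈ range h, x ^ (2 * i)) by ring,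
    hA0, t1, t2, t3, t4, t5]
  -- the parity of `d` decides `x^{m % 2}` and `x^{d − d % 2}`
  rcases Nat.mod_two_eq_zero_or_one d with hδ | hδ
  · have hm0 : m % 2 = 0 := by omega
    rw [hm0, hδ, pow_zero, Nat.sub_zero, show x ^ d = x ^ (d - 1) * x by rw [← pow_succ]; congr 1; omega]
    ring
  · have hm1' : m % 2 = 1 := by omega
    rw [hm1', hδ, pow_one]
    ring

/-- THE ARITHMETIC, `ε = −1` branch (`m = jl − d + 1`): the `+` side has no diagonal, the `−` side is all diagonal; same collapse. [folklore] -/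
theorem algebra_neg (x : ℚ) (hx1 : x ≠ 1) {d jl m : ℕ} (hd : 2 ≤ d) (hdjl : d ≤ jl) (hm : m = jl - d + 1) (hjl : jl % 2 = 0)
    (A0P A0M : ℚ) (hA0 : A0P - A0M = -x ^ (d - 1)) :
    (-1) * ((A0P + (x + 1) * x ^ (d - 1) * ∑ u ∈ range ((jl - d) / 2 + 1), x ^ u +
        ∑ i ∈ range (min (m / 2) ((jl - d) / 2)), (x ^ 2 - 1) * x ^ (2 * i + d) * ∑ u ∈ range ((jl - d) / 2 - i), x ^ u + 0) -
      (A0M + (x + 1) * x ^ d * ∑ i ∈ range (m / 2), x ^ (2 * i) + (x + 1) * x ^ (d + m - 1) * ∑ i ∈ range (jl - d - m / 2), x ^ i)) =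
      x ^ m * ((1 + (x + 1) * ∑ i ∈ range ((jl + (d - d % 2) - 2) / 2), x ^ i) - 2 * ∑ i ∈ range (d - d % 2), x ^ i) := by
  set L := (jl - d) / 2 with hL
  rw [min_eq_right (by omega : L ≤ m / 2), add_zero]
  apply mul_left_cancel₀ (sub_ne_zero.2 hx1)
  have t1 : (x - 1) * ((x + 1) * x ^ (d - 1) * ∑ u ∈ range (L + 1), x ^ u) = (x + 1) * x ^ (d - 1) * (x ^ L * x - 1) := by
    rw [show (x - 1) * ((x + 1) * x ^ (d - 1) * ∑ u ∈ range (L + 1), x ^ u) = (x + 1) * x ^ (d - 1) * ((x - 1) * ∑ u ∈ range (L + 1), x ^ u) by ring,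
      geom_sum_mul', pow_succ]
  have t2 := low_block_mul x (d := d) (L := L) (h := L) (by omega) le_rfl
  have t4 : (x - 1) * ((x + 1) * x ^ d * ∑ i ∈ range (m / 2), x ^ (2 * i)) = x ^ (d - 1) * x * (x ^ (2 * (m / 2)) - 1) := by
    rw [show (x - 1) * ((x + 1) * x ^ d * ∑ i ∈ range (m / 2), x ^ (2 * i)) = x ^ d * ((x ^ 2 - 1) * ∑ i ∈ range (m / 2), x ^ (2 * i)) by ring,
      geom_sum_two_mul, show x ^ d = x ^ (d - 1) * x by rw [← pow_succ]; congr 1; omega]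
  have t6 : (x - 1) * ((x + 1) * x ^ (d + m - 1) * ∑ i ∈ range (jl - d - m / 2), x ^ i) = (x + 1) * x ^ (d + m - 1) * (x ^ (jl - d - m / 2) - 1) := by
    rw [show (x - 1) * ((x + 1) * x ^ (d + m - 1) * ∑ i ∈ range (jl - d - m / 2), x ^ i) =
      (x + 1) * x ^ (d + m - 1) * ((x - 1) * ∑ i ∈ range (jl - d - m / 2), x ^ i) by ring, geom_sum_mul']
  have t5 : (x - 1) * (x ^ m * ((1 + (x + 1) * ∑ i ∈ range ((jl + (d - d % 2) - 2) / 2), x ^ i) - 2 * ∑ i ∈ range (d - d % 2), x ^ i)) =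
      x ^ m * ((x - 1) + (x + 1) * (x ^ ((jl + (d - d % 2) - 2) / 2) - 1) - 2 * (x ^ (d - d % 2) - 1)) := by
    rw [show (x - 1) * (x ^ m * ((1 + (x + 1) * ∑ i ∈ range ((jl + (d - d % 2) - 2) / 2), x ^ i) - 2 * ∑ i ∈ range (d - d % 2), x ^ i)) =
      x ^ m * ((x - 1) + (x + 1) * ((x - 1) * ∑ i ∈ range ((jl + (d - d % 2) - 2) / 2), x ^ i) - 2 * ((x - 1) * ∑ i ∈ range (d - d % 2), x ^ i)) by ring,
      geom_sum_mul', geom_sum_mul']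
  rw [show (x - 1) * ((-1) * ((A0P + (x + 1) * x ^ (d - 1) * ∑ u ∈ range (L + 1), x ^ u +
        ∑ i ∈ range L, (x ^ 2 - 1) * x ^ (2 * i + d) * ∑ u ∈ range (L - i), x ^ u) -
      (A0M + (x + 1) * x ^ d * ∑ i ∈ range (m / 2), x ^ (2 * i) + (x + 1) * x ^ (d + m - 1) * ∑ i ∈ range (jl - d - m / 2), x ^ i))) =
      -((x - 1) * (A0P - A0M) + (x - 1) * ((x + 1) * x ^ (d - 1) * ∑ u ∈ range (L + 1), x ^ u) +
        (x - 1) * ∑ i ∈ range L, (x ^ 2 - 1) * x ^ (2 * i + d) * ∑ u ∈ range (L - i), x ^ u -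
        (x - 1) * ((x + 1) * x ^ d * ∑ i ∈ range (m / 2), x ^ (2 * i)) -
        (x - 1) * ((x + 1) * x ^ (d + m - 1) * ∑ i ∈ range (jl - d - m / 2), x ^ i)) by ring,
    hA0, t1, t2, t4, t6, t5]
  rcases Nat.mod_two_eq_zero_or_one d with hδ | hδ
  · -- `d` even: `jl − d = 2L`, `m = 2L + 1`, `⌊m∕2⌋ = L`
    have f1 : x ^ (2 * (m / 2)) = x ^ L * x ^ L := by rw [← pow_add]; congr 1; omega
    have f2 : x ^ (d + m - 1) = x ^ L * x ^ L * x ^ (d - 1) * x := by rw [← pow_add, ← pow_add, ← pow_succ]; congr 1; omega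
    have f3 : x ^ (jl - d - m / 2) = x ^ L := by congr 1; omega
    have f4 : x ^ m = x ^ L * x ^ L * x := by rw [← pow_add, ← pow_succ]; congr 1; omega
    have f5 : x ^ ((jl + (d - d % 2) - 2) / 2) = x ^ (d - 1) * x ^ L := by rw [← pow_add]; congr 1; omega
    have f6 : x ^ (d - d % 2) = x ^ (d - 1) * x := by rw [← pow_succ]; congr 1; omega
    rw [f1, f2, f3, f4, f5, f6]; ring
  · -- `d` odd: `jl − d = 2L + 1`, `m = 2L + 2`, `⌊m∕2⌋ = L + 1`
    have f1 : x ^ (2 * (m / 2)) = x ^ L * x ^ L * x * x := by rw [← pow_add, ← pow_succ, ← pow_succ]; congr 1; omega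
    have f2 : x ^ (d + m - 1) = x ^ L * x ^ L * x ^ (d - 1) * x * x := by rw [← pow_add, ← pow_add, ← pow_succ, ← pow_succ]; congr 1; omega
    have f3 : x ^ (jl - d - m / 2) = x ^ L := by congr 1; omega
    have f4 : x ^ m = x ^ L * x ^ L * x * x := by rw [← pow_add, ← pow_succ, ← pow_succ]; congr 1; omega
    have f5 : x ^ ((jl + (d - d % 2) - 2) / 2) = x ^ (d - 1) * x ^ L := by rw [← pow_add]; congr 1; omega
    have f6 : x ^ (d - d % 2) = x ^ (d - 1) := by congr 1; omega
    rw [f1, f2, f3, f4, f5, f6]; ring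

end Summit.HodgeConjecture.HodgeConjecture.Cruxes.H413.F0P3cDyRamToricCensusSumUnrParts
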